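import Mathlib
import HarnessLib
import Literature.Geometry.Lorentzian.KerrSchild
import Literature.Geometry.Lorentzian.KerrHyperboloidalFlux

/-!
# Route StarvedNecks — crux `FutureOrientedOfSeamed` (stmt-FinalStateConjecture-17576), line `Sketch`:
# stub `stub_normSq_timeVector`

Euclidean size of the Kerr–Schild time vector `V = −g♯(dt*) = e₀ − 2H ℓ♯` on
`E4 = EuclideanSpace ℝ (Fin 4)`: in components `V = (1 + 2H, −2H ℓ₁, −2H ℓ₂, −2H ℓ₃)`, so
`‖V‖² = (1 + 2H)² + 4H² (ℓ₁² + ℓ₂² + ℓ₃²) = 1 + 4H + 8H²` wherever `r > 0` (there `|ℓ⃗| = 1`,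
`Kerr.sum_sq_nullCovectorFun`), whence `‖V‖² ≤ 13` for `0 ≤ H ≤ 1`.

References: M. Visser, *The Kerr spacetime: a brief introduction*, arXiv:0706.0622, (33)–(35);
M. Dafermos, I. Rodnianski, arXiv:0811.0354, §5.1.
-/

noncomputable section

set_option linter.dupNamespace false

open Set Filter Topology Function
open scoped Manifold ContDiff ENNReal Topology
open Literature.Geometry.Lorentzian

namespace Summit.FinalStateConjecture.FinalStateConjecture.Theorems.FutureOrientedOfSeamed.ClockDualityRays

/-- **Euclidean norm of the Kerr time vector, closed form.** For `V = e₀ − 2H ℓ♯`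
(`Kerr.timeVector`) one has `‖V‖² = 1 + 4H + 8H²` wherever `r > 0`: the components are
`(1 + 2H, −2H ℓ₁, −2H ℓ₂, −2H ℓ₃)` and `ℓ₁² + ℓ₂² + ℓ₃² = 1` (`Kerr.sum_sq_nullCovectorFun`).
Visser arXiv:0706.0622, (33)–(35). [folklore] -/
theorem normSq_timeVector_eq {M a : ℝ} {x : E4} (hx : 0 < Kerr.radius a x) :
    ‖Kerr.timeVector M a x‖ ^ 2 = 1 + 4 * Kerr.scalarH M a x + 8 * Kerr.scalarH M a x ^ 2 := by
  have hsum := Kerr.sum_sq_nullCovectorFun hx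
  rw [EuclideanSpace.real_norm_sq_eq, Fin.sum_univ_four]
  simp only [Kerr.timeVector, PiLp.sub_apply, PiLp.smul_apply, smul_eq_mul,
    PiLp.single_apply, Kerr.nullVector_apply_zero, Kerr.nullVector_apply_one,
    Kerr.nullVector_apply_two, Kerr.nullVector_apply_three]
  simp only [Fin.isValue, if_true, show (1 : Fin 4) ≠ 0 from by decide,
    show (2 : Fin 4) ≠ 0 from by decide, show (3 : Fin 4) ≠ 0 from by decide, if_false]
  linear_combination (4 * Kerr.scalarH M a x ^ 2) * hsum

/-- **Stub (Euclidean size of the Kerr time vector).** `V = e₀ − 2H ℓ♯` has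
`‖V‖² = (1 + 2H)² + 4H² |ℓ⃗|² = 1 + 4H + 8H² ≤ 13` wherever `r > 0` (`|ℓ⃗| = 1`,
`Kerr.sum_sq_nullCovectorFun`) and `0 ≤ H ≤ 1`. Visser arXiv:0706.0622, (33)–(35). [folklore] -/
theorem stub_normSq_timeVector {M a : ℝ} (hM : 0 ≤ M) {x : E4} (hx : 0 < Kerr.radius a x)
    (hH : Kerr.scalarH M a x ≤ 1) :
    ‖Kerr.timeVector M a x‖ ^ 2 ≤ 13 := by
  have h0 := Kerr.scalarH_nonneg hM a x
  rw [normSq_timeVector_eq hx]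
  nlinarith [h0, hH, mul_le_mul_of_nonneg_left hH h0]

end Summit.FinalStateConjecture.FinalStateConjecture.Theorems.FutureOrientedOfSeamed.ClockDualityRays

end
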